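import Literature.Geometry.Lorentzian.KerrBoyerLindquistData
import Literature.Geometry.Lorentzian.DataEmbeddingConstraints
import HarnessLib

/-!
# The Boyer–Lindquist Kerr data solve the vacuum constraint equations

Continuing `KerrBoyerLindquistData.lean`: the Boyer–Lindquist Kerr data `Kerr.BL.blData`
(`h = blHRepCLM`, `k = kRepCLM` on `Kerr.slice 0 ρ₁`) are, by the leaf theorems of the series, the
data INDUCED on the Boyer–Lindquist leaf `ψ = Kerr.BL.leaf` by the Kerr metric `g_{M,a}` with future
unit normal `ν = Kerr.BL.normal` (`bilin_mfderiv_leaf`, `secondFundamentalForm_leaf`), and the Kerr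
metric is Ricci-flat (`Kerr.ricci_smoothMetric`, proved in `KerrRicciFlat.lean`). The necessity
half of the constraint equations — the twice-traced Gauss equation and the traced Codazzi equation
for a spacelike immersion into a vacuum spacetime
(`PseudoRiemannianMetric.scalarCurvature_inducedMetric_sub_normSq_add_sq_eq_zero`,
`PseudoRiemannianMetric.divergence_sub_mvfderiv_meanCurvature_eq_zero`; Choquet-Bruhat 2009,
Ch. VI, Thm. 3.3; Wald 1984, (10.2.28)–(10.2.30)) — therefore gives

* `isVacuumConstraintSolution_blData` — **the Boyer–Lindquist Kerr data solve the vacuum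
  constraint equations**, for every `M ≥ 0`, spin `a` and `ρ₁ ≥ ρH`,

proved (no named fact): the replay of `InitialDataSet.isVacuumConstraintSolution_of_dataEmbedding`
for the immersion `ψ` (a data embedding packages more than the constraint argument uses). The
smoothness of the normal lift along the leaf is `contMDiff_normalLift`
(`OpensChart.contMDiffAt_lift_of_repr`, smooth representatives).

References: Y. Choquet-Bruhat, *General Relativity and the Einstein Equations* (2009), Ch. VI,
Thm. 3.3; R. M. Wald, *General Relativity* (1984), (10.2.28)–(10.2.30); S. Brandt, E. Seidel,
Phys. Rev. D 54 (1996) 1403, §II.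
-/

noncomputable section

-- instance search through the nested operator types `E3 →L[ℝ] E3 →L[ℝ] ℝ`
set_option maxSynthPendingDepth 3

open Bundle TopologicalSpace Set Module Real Filter Function
open scoped InnerProductSpace Topology ContDiff Manifold

namespace Literature.Geometry.Lorentzian

/-! ### Smooth lifts of fields along maps between chart domains -/

namespace OpensChart

variable {E : Type*} [NormedAddCommGroup E] [NormedSpace ℝ E]
  {E' : Type*} [NormedAddCommGroup E'] [NormedSpace ℝ E']
  {V : Opens E} {U : Opens E'}

/-- The lift `x ↦ (f x, ν x) ∈ TV` of a field `ν` along `f : U → V` with `C^n` representatives is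
`C^n` (companion of `mdifferentiableAt_lift_of_repr`). [folklore] -/
theorem contMDiffAt_lift_of_repr {f : U → V} {Φ : E' → E} (hf : ∀ y : U, (f y : E) = Φ y)
    {ν : NormalField 𝓘(ℝ, E) f} {N : E' → E} (hν : ∀ y : U, ν y = N y) {y : U} {n : WithTop ℕ∞}
    (hΦ : ContDiffAt ℝ n Φ y) (hN : ContDiffAt ℝ n N y) :
    ContMDiffAt 𝓘(ℝ, E') (𝓘(ℝ, E).prod 𝓘(ℝ, E)) n
      (fun x ↦ (TotalSpace.mk' E (f x) (ν x) : TangentBundle 𝓘(ℝ, E) V)) y := by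
  rw [contMDiffAt_totalSpace]
  refine ⟨?_, ?_⟩
  · have h1 : ContMDiffAt 𝓘(ℝ, E') 𝓘(ℝ, E) n (fun x : U ↦ (f x : E)) y :=
      (contMDiffAt_iff y _ Φ hf).2 hΦ
    exact (ChartedSpace.liftPropWithinAt_subtypeVal_comp_iff f Set.univ y).mp h1
  · have h : (fun x : U ↦ (trivializationAt E (TangentSpace 𝓘(ℝ, E)) (f y)
        (TotalSpace.mk' E (f x) (ν x) : TangentBundle 𝓘(ℝ, E) V)).2) = fun x : U ↦ N x := by
      funext x
      rw [show (TotalSpace.mk' E (f x) (ν x) : TangentBundle 𝓘(ℝ, E) V) = ⟨f x, N x⟩ by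
        rw [hν x], trivializationAt_apply]
    rw [h]
    exact (contMDiffAt_iff y (fun x : U ↦ N x) N (fun _ ↦ rfl)).2 hN

end OpensChart

namespace Kerr.BL

open Kerr.Ingoing InitialDataSet

variable {M a b ρ₁ : ℝ}

/-- **The normal lift along the Boyer–Lindquist leaf is smooth**: `y ↦ (leaf y, normal y) ∈ T(region)`
is `C^∞` (smooth representatives `leafRep`, `normalRep`). [cite: BrandtSeidel1996, §II] -/
theorem contMDiff_normalLift (hM : 0 ≤ M) (hρ₁ : rhoH M a ≤ ρ₁) (hb : rH M a < b) :
    ContMDiff 𝓘(ℝ, E3) 𝓘(ℝ, E4).tangent ∞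
      (fun y ↦ (TotalSpace.mk' E4 (leaf M a b ρ₁ hM hρ₁ y) (normal M a b ρ₁ hM hρ₁ y) :
        TangentBundle 𝓘(ℝ, E4) (region a 0))) := fun y ↦
  OpensChart.contMDiffAt_lift_of_repr (f := leaf M a b ρ₁ hM hρ₁) (Φ := leafRep M a b)
    (coe_leaf hM hρ₁) (ν := normal M a b ρ₁ hM hρ₁) (N := normalRep M a b) (normal_apply hM hρ₁)
    (contDiffAt_leafRep hb (rhoH_lt_norm hρ₁ y)) (contDiffAt_normalRep hM hb (rhoH_lt_norm hρ₁ y))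

/-- **The induced metric of the leaf is the metric of the Boyer–Lindquist data** (as metrics on the
slice): `ψ^* g_{M,a} = h` (`bilin_mfderiv_leaf`). [cite: BrandtSeidel1996, §II] -/
theorem inducedMetric_leaf_eq [Kerr.Facts] (hM : 0 ≤ M) (hρ₁ : rhoH M a ≤ ρ₁) (hb : rH M a < b) :
    (Kerr.smoothMetric M a 0).toPseudoRiemannianMetric.inducedMetric (leaf M a b ρ₁ hM hρ₁)
      PseudoRiemannianMetric.contMDiff_pullbackBilin_holds (isSpacelikeImmersion_leaf hM hρ₁ hb) =
      (blData hM hρ₁).metric := by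
  ext y v w
  rw [PseudoRiemannianMetric.inducedMetric_val, PseudoRiemannianMetric.inducedBilin_apply,
    InitialDataSet.val_metric, Kerr.smoothMetric_val]
  set v' : E3 := v with hv'
  set w' : E3 := w with hw'
  have hgoal : Kerr.bilin M a (leaf M a b ρ₁ hM hρ₁ y : E4)
      (mfderiv 𝓘(ℝ, E3) 𝓘(ℝ, E4) (leaf M a b ρ₁ hM hρ₁) y v')
      (mfderiv 𝓘(ℝ, E3) 𝓘(ℝ, E4) (leaf M a b ρ₁ hM hρ₁) y w') = blHRepCLM M a y v' w' := by
    rw [bilin_mfderiv_leaf hM hρ₁ hb y v' w', blHRepCLM_apply]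
  exact hgoal

/-- **The Boyer–Lindquist Kerr data solve the vacuum constraint equations** (`0 ≤ M`, any spin
`a`, `ρ₁ ≥ ρH`): they are the data induced on the Boyer–Lindquist leaf by the Ricci-flat Kerr metric
with its future unit normal, so the twice-traced Gauss equation gives the Hamiltonian constraint and
the traced Codazzi equation the momentum constraint. Choquet-Bruhat 2009, Ch. VI, Thm. 3.3;
Wald 1984, (10.2.28)–(10.2.30); Brandt–Seidel 1996, §II. [cite: ChoquetBruhat2009, Ch. VI, Thm. 3.3] -/
theorem isVacuumConstraintSolution_blData [Kerr.Facts] [(Kerr.smoothMetric M a 0).HasLeviCivita]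
    (hM : 0 ≤ M) (hρ₁ : rhoH M a ≤ ρ₁) [(blData hM hρ₁).metric.HasLeviCivita] :
    (blData hM hρ₁).IsVacuumConstraintSolution := by
  have hb : rH M a < rH M a + 1 := by linarith
  set g := (Kerr.smoothMetric M a 0).toPseudoRiemannianMetric with hg
  set f := leaf M a (rH M a + 1) ρ₁ hM hρ₁ with hf
  set ν := normal M a (rH M a + 1) ρ₁ hM hρ₁ with hνdef
  have hRic : ∀ x : region a 0, g.ricci x = 0 := Kerr.ricci_smoothMetric M a 0
  have hfi : g.IsSpacelikeImmersion 𝓘(ℝ, E3) f := isSpacelikeImmersion_leaf hM hρ₁ hb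
  have hmet := inducedMetric_leaf_eq hM hρ₁ hb
  haveI hindLC := (g.inducedMetric f PseudoRiemannianMetric.contMDiff_pullbackBilin_holds hfi).hasLeviCivita
  have hν : ContMDiff 𝓘(ℝ, E3) 𝓘(ℝ, E4).tangent ∞
      (fun y ↦ (TotalSpace.mk' E4 (f y) (ν y) : TangentBundle 𝓘(ℝ, E4) (region a 0))) :=
    contMDiff_normalLift hM hρ₁ hb
  have hun : g.IsUnitNormal 𝓘(ℝ, E3) f ν (-1) := (isFutureUnitNormal_normal hM hρ₁ hb).1
  have hm : finrank ℝ E3 = 3 := finrank_euclideanSpace_fin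
  have hm1 : finrank ℝ E4 = 3 + 1 := finrank_euclideanSpace_fin
  -- `K_ν = k`
  have hK : ∀ y, g.secondFundamentalForm 𝓘(ℝ, E3) f ν y = (blData hM hρ₁).kBilin y := by
    intro y
    refine LinearMap.ext fun v ↦ LinearMap.ext fun w ↦ ?_
    rw [InitialDataSet.kBilin_apply]
    exact secondFundamentalForm_leaf hM hρ₁ hb y v w
  have hKc : ∀ (y : slice 0 ρ₁) (v w : TangentSpace 𝓘(ℝ, E3) y),
      (blData hM hρ₁).k y v w = g.secondFundamentalForm 𝓘(ℝ, E3) f ν y v w := fun y v w ↦ by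
    rw [hK, InitialDataSet.kBilin_apply]
  -- `tr K = tr_h k` as functions
  have hH : g.meanCurvature f PseudoRiemannianMetric.contMDiff_pullbackBilin_holds hfi ν =
      (blData hM hρ₁).traceK := by
    funext y
    rw [PseudoRiemannianMetric.meanCurvature, InitialDataSet.traceK, hK,
      PseudoRiemannianMetric.trace_congr (congrArg (fun m ↦ PseudoRiemannianMetric.val m y) hmet)]
  intro x
  constructor
  · -- Hamiltonian constraint: twice-traced Gauss equation
    have hG := PseudoRiemannianMetric.scalarCurvature_inducedMetric_sub_normSq_add_sq_eq_zero g
      PseudoRiemannianMetric.contMDiff_pullbackBilin_holds hfi hν hun hm hm1 x (hRic (f x))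
    rw [InitialDataSet.hamiltonianConstraintFn, InitialDataSet.normSqK,
      ← congrFun hH x, PseudoRiemannianMetric.meanCurvature, ← hK,
      ← PseudoRiemannianMetric.scalarCurvature_eq_of_metric_eq hmet hindLC inferInstance x,
      ← PseudoRiemannianMetric.normSq_eq_of_metric_eq hmet x]
    exact hG
  · -- momentum constraint: traced Codazzi equation
    refine LinearMap.ext fun v ↦ ?_
    have hKd : MDifferentiableAt 𝓘(ℝ, E3) (𝓘(ℝ, E3).prod 𝓘(ℝ, E3 →L[ℝ] E3 →L[ℝ] ℝ))
        (fun y ↦ TotalSpace.mk' (E3 →L[ℝ] E3 →L[ℝ] ℝ)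
          (E := fun y : slice 0 ρ₁ ↦ TangentSpace 𝓘(ℝ, E3) y →L[ℝ] TangentSpace 𝓘(ℝ, E3) y →L[ℝ] ℝ)
          y ((blData hM hρ₁).k y)) x :=
      ((blData hM hρ₁).contMDiff_k x).mdifferentiableAt (by simp)
    have hMC := PseudoRiemannianMetric.divergence_sub_mvfderiv_meanCurvature_eq_zero g
      PseudoRiemannianMetric.contMDiff_pullbackBilin_holds hfi hν hun (by norm_num) hm hm1
      (blData hM hρ₁).k hKc x hKd (hRic (f x)) v
    rw [InitialDataSet.momentumConstraintFn_apply, LinearMap.zero_apply,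
      ← PseudoRiemannianMetric.divergence_eq_of_metric_eq hmet hindLC inferInstance
        (blData hM hρ₁).k x]
    rw [hH] at hMC
    exact hMC

end Kerr.BL

end Literature.Geometry.Lorentzian

end
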